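import Summits.BirchSwinnertonDyer.BirchSwinnertonDyer.Theorems.AlignedTransportAtTwoMainConjectureOfRankZeroBSDAtTwoHalfDescentLayerIndexGrowthFinite
import HarnessLib

/-!
# Route `AlignedTransportAtTwo`, crux C2 `MainConjectureOfRankZeroBSDAtTwo` (stmt-BirchSwinnertonDyer-22298):
# THE GROWTH NUMBER AT FINITE LEVEL, II (`p = 2`) — `g = γ^{2ⁿ}` is an involution of `Sel_{2^∞}(E/K_{n+1})`; with `M_{n+1} = ker(N_{K_{n+1}/K_n} | Sel_{2^∞}(E/K_{n+1}))`
# (the MINUS part `{c : g·c = −c}`) and `I_{n+1} = (g − 1)·Sel_{2^∞}(E/K_{n+1})`: `2M ⊆ I ⊆ M`; the growth number versus the finite-level norm kernel; and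
# `0 < #M_{n+1} · #ker g_{n+1} < 2^{2ⁿ}` at ANY ONE layer ⟹ `μ(X(E/K_∞)) = 0`, in any rank

HONEST FRAMING (cell `bsd-f1-sign2`, WIDTH-5 attached prover seat `bsd-line-att-p5` gen 57 on line `birth` of the lead `bsd-line-att-p2`;
`--supports` stmt-BirchSwinnertonDyer-22298, closes nothing; BSD is NOT proved by any of this; the crux C2, its verdict «blocked-on
`Rank1Residual.GreenbergMuConjectureIrreducible`» and every registered stub (P / T / Kμ / LimDoor / MuIneqʳ / PFμ⁺) are untouched). THEOREMS ONLY — no `def`,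
no instance, no named fact, no `sorry`. Route-independent (any number field `K`, any `ℤ₂`-extension, any Pontryagin-dual datum, any rank); the seed
composition (`K = ℚ`, crux by name) is the sibling `…GrowthFiniteSeed`. Sequel of `…HalfDescentLayerIndexGrowthFinite` (any `p`: `g_n·#(ker h_{n+1} ⊓ I_{n+1}) ∣ #I_{n+1}·#coker s_{n+1}`,
`#I_{n+1} ∣ g_n·#ker s_{n+1}`, and `0 < #I_{n+1}·#ker g_{n+1} < p^{pⁿ(p−1)}` ⟹ `μ = 0`) and the finite-level twin of gen 56's `…GrowthTwo` (the same sandwich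
`2M ⊆ I ⊆ M` for `σ = conj_γ^{2ⁿ}` on the LIMIT Selmer group).

* §1 (an involution `σ` of an abelian group `X`, `σ`-stable `S ≤ X`; `I = (σ − 1)S`, `M = S ∩ ker(σ + 1)`): `map_sub_id_le_inf_ker` (`I ≤ M`), `two_nsmul_mem_map_sub_id`
  (`2M ⊆ I`), ★ `natCard_map_sub_id_dvd` (`#I ∣ #M`), ★ `natCard_inf_ker_dvd_mul` (`#M ∣ #I · #(M ∩ X[2])`).
* §2 (`p = 2`, `X = H¹(K_{n+1}, E[2^∞])`, `σ = conj_g`, `g = γ^{2ⁿ}`): `conjH1_pow_comp_self` — **`conj_g² = 1`** (`g² = γ^{2^{n+1}} ∈ Gal(K̄/K_{n+1})`), so `1 + conj_g` is the relative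
  norm of the quadratic layer `K_{n+1}/K_n` and `M_{n+1} = Sel_{2^∞}(E/K_{n+1}) ∩ ker(conj_g + 1)` its kernel on the Selmer group (the minus part);
  ★★ `natCard_map_dvd_natCard_normKer` (`#I_{n+1} ∣ #M_{n+1}`), ★★ `natCard_normKer_dvd_mul` (`#M_{n+1} ∣ #I_{n+1} · #M_{n+1}[2]`),
  ★★ `natCard_growth_mul_dvd_normKer_and_dvd`: **`g_n · #(ker h_{n+1} ⊓ I_{n+1}) ∣ #M_{n+1} · #coker s_{n+1}`** and **`#M_{n+1} ∣ g_n · #ker s_{n+1} · #M_{n+1}[2]`** —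
  the growth number of `X(E/K_∞)` and the norm kernel on the honest finite-level Selmer group agree up to the control kernel/cokernel and `2`-torsion; no hypothesis.
* §3 ★★★ `mu_eq_zero_of_natCard_normKer_mul_kerG_lt` / `…_mul_cokerS_lt`: **`0 < #ker(N_{K_{n+1}/K_n} | Sel_{2^∞}(E/K_{n+1})) · #ker g_{n+1} < 2^{2ⁿ}`** at SOME `n`
  ⟹ **`μ(X(E/K_∞)) = 0`** (any rank; `X` f.g. torsion) — gen 55's limit certificate `#ker((1 + conj_γ^{2ⁿ}) | Sel_∞) < 2^{2ⁿ}` brought down to `K_{n+1}`.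
What is NOT claimed: nothing about any curve; no Selmer group computed; C2 untouched. Memo `Cruxes/MainConjectureOfRankZeroBSDAtTwo/GROWTH-FINITE-att-p5-g57.md`.

References: R. Greenberg, LNM 1716 (1999), §1 pp. 60–65, Conj. 1.11, §3 Lemmas 3.1–3.3 and pp. 85–86, §4 Thm. 4.1 (p. 102), Lemma 4.3 (p. 103) [GreenbergLNM1716];
B. Mazur, Invent. Math. 18 (1972) §6 [Mazur1972]; L. Washington, GTM 83 §13.3 [Washington1997]; J. Neukirch, A. Schmidt, K. Wingberg, *Cohomology of Number Fields*, I.§5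
[NeukirchSchmidtWingberg2008].
-/

set_option linter.dupNamespace false
set_option autoImplicit false

noncomputable section

open scoped Classical AddSubgroup Polynomial

universe u

namespace Summit.BirchSwinnertonDyer.BirchSwinnertonDyer.Theorems.AlignedTransportAtTwoHalfDescentLayerIndexGrowthFiniteTwo

open WeierstrassCurve Literature.NumberTheory.EllipticCurves Literature.NumberTheory.EllipticCurves.IwasawaDual
  Literature.NumberTheory.EllipticCurves.IwasawaAlgebra
  Summit.BirchSwinnertonDyer.Rank1Residual.X1.MuLambda
  Summit.BirchSwinnertonDyer.Rank1Residual.Iwasawa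
  Summit.BirchSwinnertonDyer.BirchSwinnertonDyer.Theorems.AlignedTransportAtTwoHalfDescentLayerIndexGrowthFinite

/-! ## §1 An involution `σ` of an abelian group `X` and a `σ`-stable subgroup `S`: `2·M ⊆ I ⊆ M`, `I = (σ − 1)S`, `M = S ∩ ker(σ + 1)` -/

section Involution

variable {X : Type*} [AddCommGroup X] (σ : X →+ X) (S : AddSubgroup X)

/-- `σ² = 1` pointwise. [folklore] -/
theorem apply_apply_eq_self (hσ : σ.comp σ = AddMonoidHom.id X) (x : X) : σ (σ x) = x := by
  have h := congrArg (fun f ↦ f x) hσ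
  simpa only [AddMonoidHom.coe_comp, Function.comp_apply, AddMonoidHom.id_apply] using h

/-- **`(σ − 1)·S ≤ S ∩ ker(σ + 1)`** for an involution `σ` and a `σ`-stable subgroup `S` (`(σ + 1)(σ − 1) = σ² − 1 = 0`). [folklore] -/
theorem map_sub_id_le_inf_ker (hσ : σ.comp σ = AddMonoidHom.id X) (hS : ∀ c ∈ S, σ c ∈ S) :
    S.map (σ - AddMonoidHom.id X) ≤ S ⊓ (σ + AddMonoidHom.id X).ker := by
  rintro _ ⟨c, hc, rfl⟩
  refine AddSubgroup.mem_inf.mpr ⟨?_, ?_⟩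
  · rw [AddMonoidHom.sub_apply, AddMonoidHom.id_apply]
    exact sub_mem (hS c hc) hc
  · rw [AddMonoidHom.mem_ker, AddMonoidHom.sub_apply, AddMonoidHom.id_apply, AddMonoidHom.add_apply, AddMonoidHom.id_apply, map_sub,
      apply_apply_eq_self σ hσ]
    abel

/-- `c ∈ S ∩ ker(σ + 1)` means `c ∈ S` and `σ c = −c`. [folklore] -/
theorem apply_eq_neg_of_mem_inf_ker {c : X} (hc : c ∈ S ⊓ (σ + AddMonoidHom.id X).ker) : σ c = -c := by
  have h := (AddMonoidHom.mem_ker).mp (AddSubgroup.mem_inf.mp hc).2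
  rw [AddMonoidHom.add_apply, AddMonoidHom.id_apply] at h
  exact eq_neg_of_add_eq_zero_left h

/-- **`2·(S ∩ ker(σ + 1)) ⊆ (σ − 1)·S`**: for `σc = −c`, `2c = (σ − 1)(−c)`. [folklore] -/
theorem two_nsmul_mem_map_sub_id {c : X} (hc : c ∈ S ⊓ (σ + AddMonoidHom.id X).ker) : (2 : ℕ) • c ∈ S.map (σ - AddMonoidHom.id X) := by
  have hσc := apply_eq_neg_of_mem_inf_ker σ S hc
  refine ⟨-c, neg_mem (AddSubgroup.mem_inf.mp hc).1, ?_⟩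
  rw [AddMonoidHom.sub_apply, AddMonoidHom.id_apply, map_neg, hσc, neg_neg, sub_neg_eq_add, two_nsmul]

/-- ★ **`#((σ − 1)·S) ∣ #(S ∩ ker(σ + 1))`** (`Nat.card`). [folklore] -/
theorem natCard_map_sub_id_dvd (hσ : σ.comp σ = AddMonoidHom.id X) (hS : ∀ c ∈ S, σ c ∈ S) :
    Nat.card ↥(S.map (σ - AddMonoidHom.id X)) ∣ Nat.card ↥(S ⊓ (σ + AddMonoidHom.id X).ker) :=
  AddSubgroup.card_dvd_of_le (map_sub_id_le_inf_ker σ S hσ hS)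

/-- ★ **`#(S ∩ ker(σ + 1)) ∣ #((σ − 1)·S) · #(S ∩ ker(σ + 1) ∩ X[2])`**: multiplication by `2` maps `M = S ∩ ker(σ + 1)` into `I = (σ − 1)·S` with kernel `M[2]`.
[folklore] -/
theorem natCard_inf_ker_dvd_mul :
    Nat.card ↥(S ⊓ (σ + AddMonoidHom.id X).ker) ∣
      Nat.card ↥(S.map (σ - AddMonoidHom.id X)) * Nat.card ↥(S ⊓ (σ + AddMonoidHom.id X).ker ⊓ AddSubgroup.torsionBy X 2) := by
  set M : AddSubgroup X := S ⊓ (σ + AddMonoidHom.id X).ker with hM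
  set I : AddSubgroup X := S.map (σ - AddMonoidHom.id X) with hI
  set d : ↥M →+ X := ((2 : ℕ) • AddMonoidHom.id X).comp M.subtype with hd
  have hd_apply : ∀ c : ↥M, d c = (2 : ℕ) • (c : X) := fun c ↦ rfl
  have hrange : d.range ≤ I := by
    rintro _ ⟨c, rfl⟩
    rw [hd_apply]
    exact two_nsmul_mem_map_sub_id σ S c.2
  have hker : Nat.card d.ker = Nat.card ↥(M ⊓ AddSubgroup.torsionBy X 2) := by
    have hmem : ∀ c : ↥M, c ∈ d.ker ↔ (c : X) ∈ AddSubgroup.torsionBy X 2 := fun c ↦ by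
      rw [AddMonoidHom.mem_ker, hd_apply]
      exact (AddSubgroup.torsionBy.nsmul_iff (A := X) (n := 2)).symm
    refine Nat.card_congr ⟨fun c ↦ ⟨(c.1 : X), AddSubgroup.mem_inf.mpr ⟨c.1.2, (hmem c.1).mp c.2⟩⟩,
      fun x ↦ ⟨⟨x.1, (AddSubgroup.mem_inf.mp x.2).1⟩, (hmem _).mpr (AddSubgroup.mem_inf.mp x.2).2⟩, fun _ ↦ rfl, fun _ ↦ rfl⟩
  have hsplit : Nat.card ↥M = Nat.card d.range * Nat.card d.ker := by
    rw [AddSubgroup.card_eq_card_quotient_mul_card_addSubgroup d.ker, Nat.card_congr (QuotientAddGroup.quotientKerEquivRange d).toEquiv]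
  rw [hsplit, hker]
  exact mul_dvd_mul_right (AddSubgroup.card_dvd_of_le hrange) _

end Involution

/-! ## §2 `p = 2`: `g = γ^{2ⁿ}` is an involution of `H¹(K_{n+1}, E[2^∞])`; minus part / norm kernel `M_{n+1}`, image `I_{n+1}`, and the growth number -/

section Selmer

variable {K : Type u} [Field K] [NumberField K] (W : WeierstrassCurve K) (κ : ZpExtension K 2) {γ : Field.absoluteGaloisGroup K}

omit [NumberField K] in
/-- `p = 2`: **`conj_g ∘ conj_g = id` on `H¹(K_{n+1}, E[2^∞])`** for `g = γ^{2ⁿ}` (`g² = γ^{2^{n+1}} ∈ Gal(K̄/K_{n+1})` acts trivially: tree `conjH1_mul_holds`,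
`conjH1_of_mem_holds`, `ZpExtension.pow_mem_layerSubgroup`) — `g` generates `Gal(K_{n+1}/K_n)` and `1 + conj_g` is the relative norm `N_{K_{n+1}/K_n}` on `H¹(K_{n+1}, ·)`.
[cite: GreenbergLNM1716, §3 p. 85] [cite: NeukirchSchmidtWingberg2008, I.§5] -/
theorem conjH1_pow_comp_self (hγ : κ.IsTopGenerator γ) (n : ℕ) :
    (W.conjH1 2 (κ.layerSubgroup (n + 1)) (γ ^ 2 ^ n)).comp (W.conjH1 2 (κ.layerSubgroup (n + 1)) (γ ^ 2 ^ n)) =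
      AddMonoidHom.id (W.subgroupH1 2 (κ.layerSubgroup (n + 1))) := by
  rw [← W.conjH1_mul_holds 2 (κ.layerSubgroup (n + 1)) (γ ^ 2 ^ n) (γ ^ 2 ^ n), ← pow_add, ← two_mul, ← pow_succ']
  exact W.conjH1_of_mem_holds 2 (κ.layerSubgroup (n + 1)) (κ.pow_mem_layerSubgroup hγ (n + 1))

/-- `Sel_{2^∞}(E/K_{n+1})` is `conj_g`-stable. [cite: GreenbergLNM1716, §1 (after Conj. 1.3)] -/
theorem conjH1_mem_selmerLayer (m : ℕ) (g : Field.absoluteGaloisGroup K) :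
    ∀ c ∈ W.selmerLayer κ m, W.conjH1 2 (κ.layerSubgroup m) g c ∈ W.selmerLayer κ m :=
  fun c hc ↦ W.map_conjH1_selmerGroupOver_le_holds 2 (κ.layerSubgroup m) g ⟨c, hc, rfl⟩

/-- ★★ `p = 2`: **`#I_{n+1} ∣ #M_{n+1}`**, `I_{n+1} = (conj_g − 1)·Sel_{2^∞}(E/K_{n+1})`, `M_{n+1} = Sel_{2^∞}(E/K_{n+1}) ∩ ker(conj_g + 1) = {c : g·c = −c}` = the kernel of the
relative norm `N_{K_{n+1}/K_n} = 1 + g` on `Sel_{2^∞}(E/K_{n+1})` (indeed `I_{n+1} ≤ M_{n+1}`). [cite: GreenbergLNM1716, §3 p. 85] [cite: Mazur1972, §6] -/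
theorem natCard_map_dvd_natCard_normKer (hγ : κ.IsTopGenerator γ) (n : ℕ) :
    Nat.card ↥((W.selmerLayer κ (n + 1)).map
        (W.conjH1 2 (κ.layerSubgroup (n + 1)) (γ ^ 2 ^ n) - AddMonoidHom.id (W.subgroupH1 2 (κ.layerSubgroup (n + 1))))) ∣
      Nat.card ↥(W.selmerLayer κ (n + 1) ⊓
        (W.conjH1 2 (κ.layerSubgroup (n + 1)) (γ ^ 2 ^ n) + AddMonoidHom.id (W.subgroupH1 2 (κ.layerSubgroup (n + 1)))).ker) :=
  natCard_map_sub_id_dvd _ _ (conjH1_pow_comp_self W κ hγ n) (conjH1_mem_selmerLayer W κ (n + 1) (γ ^ 2 ^ n))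

/-- ★★ `p = 2`: **`#M_{n+1} ∣ #I_{n+1} · #(M_{n+1} ∩ H¹(K_{n+1}, E[2^∞])[2])`** (`2·M_{n+1} ⊆ I_{n+1} ⊆ M_{n+1}`): the norm kernel and the image of `g − 1` on
`Sel_{2^∞}(E/K_{n+1})` differ by a factor dividing the order of the `2`-torsion of the norm kernel. No hypothesis. [cite: GreenbergLNM1716, §3 p. 85] [cite: Mazur1972, §6] -/
theorem natCard_normKer_dvd_mul (n : ℕ) :
    Nat.card ↥(W.selmerLayer κ (n + 1) ⊓
        (W.conjH1 2 (κ.layerSubgroup (n + 1)) (γ ^ 2 ^ n) + AddMonoidHom.id (W.subgroupH1 2 (κ.layerSubgroup (n + 1)))).ker) ∣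
      Nat.card ↥((W.selmerLayer κ (n + 1)).map
          (W.conjH1 2 (κ.layerSubgroup (n + 1)) (γ ^ 2 ^ n) - AddMonoidHom.id (W.subgroupH1 2 (κ.layerSubgroup (n + 1))))) *
        Nat.card ↥(W.selmerLayer κ (n + 1) ⊓
            (W.conjH1 2 (κ.layerSubgroup (n + 1)) (γ ^ 2 ^ n) + AddMonoidHom.id (W.subgroupH1 2 (κ.layerSubgroup (n + 1)))).ker ⊓
          AddSubgroup.torsionBy (W.subgroupH1 2 (κ.layerSubgroup (n + 1))) 2) :=
  natCard_inf_ker_dvd_mul _ _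

/-- ★★ `p = 2`: **THE NORM KERNEL AT FINITE LEVEL VERSUS THE GROWTH NUMBER.** For EVERY Pontryagin-dual datum over a `ℤ₂`-extension and EVERY `n` (`g_n = #(ω_nX/ω_{n+1}X)`,
`M_{n+1} = ker(N_{K_{n+1}/K_n} | Sel_{2^∞}(E/K_{n+1}))`, `I_{n+1} = (g − 1)·Sel_{2^∞}(E/K_{n+1})`, `s_{n+1}` the control map, `h_{n+1}` restriction):
**`g_n · #(ker h_{n+1} ⊓ I_{n+1}) ∣ #M_{n+1} · #coker s_{n+1}`** and **`#M_{n+1} ∣ g_n · #ker s_{n+1} · #(M_{n+1}[2])`** — no hypothesis.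
[cite: GreenbergLNM1716, §1 pp. 60–65, §3 pp. 85–86, §4 Lemma 4.3] [cite: Mazur1972, §6] -/
theorem natCard_growth_mul_dvd_normKer_and_dvd (hγ : κ.IsTopGenerator γ) (D : W.SelmerDualData κ γ) (n : ℕ) :
    (Nat.card (↥(Ideal.span {((1 + PowerSeries.X : PowerSeries ℤ_[2]) ^ (2 ^ n) - 1 : IwasawaAlgebra 2)} • ⊤ : Submodule (IwasawaAlgebra 2) D.X) ⧸
          (Ideal.span {(((Polynomial.cyclotomic (2 ^ (n + 1)) ℤ_[2]).comp (Polynomial.X + 1) : ℤ_[2][X]) : IwasawaAlgebra 2)} • ⊤ :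
            Submodule (IwasawaAlgebra 2) ↥(Ideal.span {((1 + PowerSeries.X : PowerSeries ℤ_[2]) ^ (2 ^ n) - 1 : IwasawaAlgebra 2)} • ⊤ :
              Submodule (IwasawaAlgebra 2) D.X))) *
        Nat.card ↥((W.layerToInfty κ (n + 1)).ker ⊓ (W.selmerLayer κ (n + 1)).map
          (W.conjH1 2 (κ.layerSubgroup (n + 1)) (γ ^ 2 ^ n) - AddMonoidHom.id (W.subgroupH1 2 (κ.layerSubgroup (n + 1))))) ∣
      Nat.card ↥(W.selmerLayer κ (n + 1) ⊓
          (W.conjH1 2 (κ.layerSubgroup (n + 1)) (γ ^ 2 ^ n) + AddMonoidHom.id (W.subgroupH1 2 (κ.layerSubgroup (n + 1)))).ker) *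
        Nat.card (W.CokerS κ (n + 1))) ∧
    (Nat.card ↥(W.selmerLayer κ (n + 1) ⊓
          (W.conjH1 2 (κ.layerSubgroup (n + 1)) (γ ^ 2 ^ n) + AddMonoidHom.id (W.subgroupH1 2 (κ.layerSubgroup (n + 1)))).ker) ∣
      Nat.card (↥(Ideal.span {((1 + PowerSeries.X : PowerSeries ℤ_[2]) ^ (2 ^ n) - 1 : IwasawaAlgebra 2)} • ⊤ : Submodule (IwasawaAlgebra 2) D.X) ⧸
          (Ideal.span {(((Polynomial.cyclotomic (2 ^ (n + 1)) ℤ_[2]).comp (Polynomial.X + 1) : ℤ_[2][X]) : IwasawaAlgebra 2)} • ⊤ :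
            Submodule (IwasawaAlgebra 2) ↥(Ideal.span {((1 + PowerSeries.X : PowerSeries ℤ_[2]) ^ (2 ^ n) - 1 : IwasawaAlgebra 2)} • ⊤ :
              Submodule (IwasawaAlgebra 2) D.X))) *
        Nat.card ↥((W.layerToInfty κ (n + 1)).ker ⊓ W.selmerLayer κ (n + 1)) *
        Nat.card ↥(W.selmerLayer κ (n + 1) ⊓
            (W.conjH1 2 (κ.layerSubgroup (n + 1)) (γ ^ 2 ^ n) + AddMonoidHom.id (W.subgroupH1 2 (κ.layerSubgroup (n + 1)))).ker ⊓
          AddSubgroup.torsionBy (W.subgroupH1 2 (κ.layerSubgroup (n + 1))) 2)) := by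
  obtain ⟨h1, h2⟩ := natCard_growth_mul_dvd_and_dvd W κ hγ D n
  exact ⟨h1.trans (mul_dvd_mul_right (natCard_map_dvd_natCard_normKer W κ hγ n) _),
    (natCard_normKer_dvd_mul W κ n).trans (mul_dvd_mul_right h2 _)⟩

/-! ## §3 The certificate at `p = 2`: one small finite-level norm kernel -/

/-- ★★★ `p = 2`: **`μ = 0` FROM ONE SMALL NORM KERNEL AT FINITE LEVEL, ANY RANK.** `E/K`, `κ` any `ℤ₂`-extension with topological generator `γ`, `D` any Pontryagin-dual datum
with `X` finitely generated torsion. If at SOME `n` (`g = γ^{2ⁿ}`, `ker g_{n+1} = A_{n+1}/Sel_{n+1}` Greenberg's control kernel):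
**`0 < #ker(N_{K_{n+1}/K_n} | Sel_{2^∞}(E/K_{n+1})) · #ker g_{n+1} < 2^{2ⁿ}`**, then **`μ(X(E/K_∞)) = 0`** — gen 55's relative-norm-kernel certificate
(`#ker((1 + conj_γ^{2ⁿ}) | Sel_∞) < 2^{2ⁿ}`) ONE LEVEL DOWN, on the honest finite-level Selmer group. [cite: GreenbergLNM1716, Conj. 1.11, §3 Lemmas 3.1–3.3, §4 Lemma 4.3]
[cite: Mazur1972, §6] [cite: Washington1997, §13.3 Thm. 13.13] -/
theorem mu_eq_zero_of_natCard_normKer_mul_kerG_lt (hγ : κ.IsTopGenerator γ) (D : W.SelmerDualData κ γ) [Module.Finite (IwasawaAlgebra 2) D.X]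
    (hD : D.IsTorsion) {n : ℕ}
    (hpos : 0 < Nat.card ↥(W.selmerLayer κ (n + 1) ⊓
        (W.conjH1 2 (κ.layerSubgroup (n + 1)) (γ ^ 2 ^ n) + AddMonoidHom.id (W.subgroupH1 2 (κ.layerSubgroup (n + 1)))).ker) *
      Nat.card (W.KerG κ (n + 1)))
    (hlt : Nat.card ↥(W.selmerLayer κ (n + 1) ⊓
        (W.conjH1 2 (κ.layerSubgroup (n + 1)) (γ ^ 2 ^ n) + AddMonoidHom.id (W.subgroupH1 2 (κ.layerSubgroup (n + 1)))).ker) *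
      Nat.card (W.KerG κ (n + 1)) < 2 ^ (2 ^ n)) : D.mu = 0 := by
  obtain ⟨hMpos, hGpos⟩ := CanonicallyOrderedAdd.mul_pos.mp hpos
  have hdvd := natCard_map_dvd_natCard_normKer W κ hγ n
  have hIpos := Nat.pos_of_dvd_of_pos hdvd hMpos
  have hIle := Nat.le_of_dvd hMpos hdvd
  refine mu_eq_zero_of_natCard_map_selmerLayer_mul_kerG_lt W κ hγ D hD (Nat.mul_pos hIpos hGpos) ?_
  rw [show (2 : ℕ) - 1 = 1 from rfl, mul_one]
  exact (Nat.mul_le_mul_right _ hIle).trans_lt hlt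

/-- ★★★ `p = 2`, cokernel form: **`0 < #ker(N_{K_{n+1}/K_n} | Sel_{2^∞}(E/K_{n+1})) · #coker s_{n+1} < 2^{2ⁿ}` ⟹ `μ(X(E/K_∞)) = 0`** (`#coker s_{n+1} ∣ #ker g_{n+1}`).
[cite: GreenbergLNM1716, Conj. 1.11, §3 pp. 85–86, §4 Lemma 4.3] -/
theorem mu_eq_zero_of_natCard_normKer_mul_cokerS_lt (hγ : κ.IsTopGenerator γ) (D : W.SelmerDualData κ γ) [Module.Finite (IwasawaAlgebra 2) D.X]
    (hD : D.IsTorsion) {n : ℕ}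
    (hpos : 0 < Nat.card ↥(W.selmerLayer κ (n + 1) ⊓
        (W.conjH1 2 (κ.layerSubgroup (n + 1)) (γ ^ 2 ^ n) + AddMonoidHom.id (W.subgroupH1 2 (κ.layerSubgroup (n + 1)))).ker) *
      Nat.card (W.CokerS κ (n + 1)))
    (hlt : Nat.card ↥(W.selmerLayer κ (n + 1) ⊓
        (W.conjH1 2 (κ.layerSubgroup (n + 1)) (γ ^ 2 ^ n) + AddMonoidHom.id (W.subgroupH1 2 (κ.layerSubgroup (n + 1)))).ker) *
      Nat.card (W.CokerS κ (n + 1)) < 2 ^ (2 ^ n)) : D.mu = 0 := by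
  obtain ⟨hMpos, hCpos⟩ := CanonicallyOrderedAdd.mul_pos.mp hpos
  have hdvd := natCard_map_dvd_natCard_normKer W κ hγ n
  have hIpos := Nat.pos_of_dvd_of_pos hdvd hMpos
  have hIle := Nat.le_of_dvd hMpos hdvd
  refine mu_eq_zero_of_natCard_map_selmerLayer_mul_cokerS_lt W κ hγ D hD (Nat.mul_pos hIpos hCpos) ?_
  rw [show (2 : ℕ) - 1 = 1 from rfl, mul_one]
  exact (Nat.mul_le_mul_right _ hIle).trans_lt hlt

end Selmer

end Summit.BirchSwinnertonDyer.BirchSwinnertonDyer.Theorems.AlignedTransportAtTwoHalfDescentLayerIndexGrowthFiniteTwo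

end
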